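import Summits.BirchSwinnertonDyer.BirchSwinnertonDyer.Theorems.ManinLocalTwoThreeShimuraThreeKernelLine
import Literature.NumberTheory.EllipticCurves.PeriodLatticeGamma1QuotientProofs
import Literature.NumberTheory.EllipticCurves.ModularSymbolsPeriodHomology
import Literature.NumberTheory.EllipticCurves.NewformsHeckeProofs
import HarnessLib

/-!
# THE EISENSTEIN CONGRUENCE OF THE SHIMURA QUOTIENT (unconditional): `T_p f = a_p f`, `p ∤ N` ⟹ `(a_p − p − 1)·Λ₀(f) ⊆ Λ₁(f)`; at `9 ∣ N` a Shimura `3`-kernel forces `a_p(W) ≡ p + 1 (mod 3)` for every prime `p ∤ N`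
(route `ManinLocalTwoThree`, crux C3 `ManinPrimeToThreeAtNine` stmt-BirchSwinnertonDyer-22968; cell bsd-f2-manin, C3 LEAD p1 gen 17;
`--supports stmt-BirchSwinnertonDyer-22968`; node E-an-221 — sixth habitat file; arithmetic shadow: `T_p` acts on the Shimura subgroup `Σ(N)` by `1 + p` and on
`E₀` by `a_p`, so `(a_p − 1 − p)·(E₀ ∩ Σ(N)) = 0` — the μ-type / Eisenstein nature of `Σ(N)` (Ling–Oesterlé), i.e. the representation-theoretic content of
-an's E-an-201R, in the tree's lattice currency)

THE LATTICE PROOF.  For `γ = (a b; c d) ∈ Γ₀(N)` with `p ∤ c ≠ 0`, the tree's Hecke action on symbols (`modularSymbol_heckeT_eq_sum`, Cremona (2.4.1)):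
`a_p·{∞, a/c}_f = {∞, γ∞}_{T_p f} = ∑_{j mod p} {∞, (a + jc)/(pc)}_f + {∞, pa/c}_f`.  Every term is a period `{∞, δ∞}_f` for an explicit `δ = Gamma0.mkOfCol …`
whose lower-right entry is determined MOD `N` by its top-left entry (`u·d_δ ≡ 1`): for the `p − 1` indices `j` with `p ∤ a + jc` one gets `d_δ ≡ d` (same class as
`γ`), for the unique `j₀` with `a + j₀c = p·a₀` one gets `d_δ ≡ p·d`, and for the last term `d_δ ≡ p⁻¹·d`; since `θ(γ) = {∞,γ∞} mod Λ₁` is multiplicative in `d`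
(`Gamma0Map`), the two odd terms sum to `2θ(γ)`, whence `a_p θ(γ) = (p + 1) θ(γ)`.
* §1 `sub_mul_cuspSymbol_mem_periodLatticeGamma1_of_heckeT` (the core, `p ∤ c`), `…_of_heckeT'` (every `γ`, via a representative with `c = N`);
* §2 at `9 ∣ N` under `KummerShimura D u` (`Λ₁ = ℤ(3u/c) + 3Λ₀`, index 3): **`three_dvd_lFunction_sub_of_kummerShimura` — `3 ∣ a_p(W) − p − 1` for every prime `p ∤ N`**
  (`T_p f = a_p f` for the newform, tree theorem `IsNewform0.heckeT_eq_coeff_smul`; `a_p(f) = a_p(W) ∈ ℤ` by `IsNewformOf`).  So on E-an-221's habitat the curve is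
  Eisenstein mod 3 at EVERY good prime — the generic-character isolated classes (`ψ ∉ {1, ω}`: some `a_p ≢ 1 + p`) are OFF the Shimura branch unconditionally
  (GENΣ, all cases, by one `a_p`).

HONEST FRAMING.  Unconditional theorems about the tree's period lattices; E-an-221 on its habitat, RES₃♭, C3, Manin's conjecture and BSD are NOT proved.  No definitions,
no named facts, no sorry.
[cite: CremonaAlgorithms1997, §2.4 (2.4.1)–(2.4.2) (Hecke operators on modular symbols)] [cite: LingOesterle1991, §1, Thm. 1 (shape: Σ(N) is Eisenstein)]
[cite: DiamondShurman2005, Prop. 5.8.5 (T_p f = a_p f for a newform)] [cite: Manin1972, Prop. 1.4 / Thm. 1.6]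
-/

set_option autoImplicit false
-- lint-debt: the directory name repeats the summit name (sibling precedent `ManinLocalTwoThreeShimuraThreeKernelLine.lean`)
set_option linter.dupNamespace false

noncomputable section

open scoped Classical ComplexConjugate MatrixGroups ModularForm PeriodPair
open CongruenceSubgroup Complex
open WeierstrassCurve Literature.NumberTheory.EllipticCurves Literature.NumberTheory.EllipticCurves.ModularForms
open Summit.BirchSwinnertonDyer.Rank1Residual.ManinAdditive.CuspidalKummer
open Summit.BirchSwinnertonDyer.Rank1Residual.ManinAdditive.CuspidalKummerThree
open Summit.BirchSwinnertonDyer.Rank1Residual.ManinAdditive.UDCKummerLine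
open Summit.BirchSwinnertonDyer.Rank1Residual.ManinAdditive.UDCKummerLineK
open Summit.BirchSwinnertonDyer.Rank1Residual.ManinAdditive.ShimuraThreeTorsion

namespace Summit.BirchSwinnertonDyer.BirchSwinnertonDyer.Theorems.ManinLocalTwoThree.SigmaHabitat

section Hecke

variable {N : ℕ}

/-- The lower-right entry of a product is the product of the lower-right entries modulo `N` (`Gamma0Map`). [folklore] -/
theorem cast_apply_one_one_mul (A B : Gamma0 N) :
    ((((A * B : Gamma0 N) : SL(2, ℤ)) 1 1 : ℤ) : ZMod N) = (((A : SL(2, ℤ)) 1 1 : ℤ) : ZMod N) * (((B : SL(2, ℤ)) 1 1 : ℤ) : ZMod N) :=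
  map_mul (Gamma0Map N) A B

/-- `a_δ · d_δ ≡ 1 (mod N)` for `δ ∈ Γ₀(N)`. [folklore] -/
theorem cast_apply_zero_zero_mul_apply_one_one (δ : Gamma0 N) :
    ((((δ : SL(2, ℤ)) 0 0 : ℤ)) : ZMod N) * (((δ : SL(2, ℤ)) 1 1 : ℤ) : ZMod N) = 1 := by
  have hdet := Matrix.det_fin_two (δ : SL(2, ℤ)).1
  rw [Matrix.SpecialLinearGroup.det_coe] at hdet
  have hc : ((((δ : SL(2, ℤ)) 1 0 : ℤ)) : ZMod N) = 0 := Gamma0_mem.mp δ.2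
  have h := congrArg (fun x : ℤ ↦ (x : ZMod N)) hdet
  simp only [Int.cast_one, Int.cast_sub, Int.cast_mul, hc, mul_zero, sub_zero] at h
  exact h.symm

variable [NeZero N] (f : CuspForm (Gamma0 N) 2)

/-- **THE EISENSTEIN CONGRUENCE (core; UNCONDITIONAL).**  `T_p f = a_p f` with `a_p ∈ ℤ`, `p ∤ N` prime, `γ = (a b; c d) ∈ Γ₀(N)` with `c ≠ 0`, `p ∤ c` ⟹
`(a_p − p − 1)·{∞, γ∞}_f ∈ Λ₁(f)`. [cite: CremonaAlgorithms1997, §2.4 (2.4.1)] -/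
theorem sub_mul_cuspSymbol_mem_periodLatticeGamma1_of_heckeT {p : ℕ} [Fact p.Prime] (hpN : ¬ p ∣ N) {ap : ℤ}
    (hT : heckeT (Gamma0 N) 2 p f = (ap : ℂ) • f) (γ : Gamma0 N)
    (hc : ((γ : SL(2, ℤ)) 1 0 : ℤ) ≠ 0) (hpc : ¬ (p : ℤ) ∣ ((γ : SL(2, ℤ)) 1 0 : ℤ)) :
    ((ap : ℂ) - p - 1) * cuspSymbol f γ ∈ periodLatticeGamma1 f := by
  have hp : p.Prime := Fact.out
  have hp0 : p ≠ 0 := hp.ne_zero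
  have hpP : Prime (p : ℤ) := Nat.prime_iff_prime_int.mp hp
  set a : ℤ := (γ : SL(2, ℤ)) 0 0 with ha
  set c : ℤ := (γ : SL(2, ℤ)) 1 0 with hcc
  set d : ℤ := (γ : SL(2, ℤ)) 1 1 with hdd
  have hac : IsCoprime a c := Matrix.SpecialLinearGroup.isCoprime_col (γ : SL(2, ℤ)) 0
  have hNc : (N : ℤ) ∣ c := dvd_entry_of_mem_Gamma0 N γ.2
  have hcN : ((c : ℤ) : ZMod N) = 0 := (ZMod.intCast_zmod_eq_zero_iff_dvd c N).mpr hNc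
  have had : ((a : ℤ) : ZMod N) * ((d : ℤ) : ZMod N) = 1 := cast_apply_zero_zero_mul_apply_one_one γ
  have hc' : (c : ℚ) ≠ 0 := by exact_mod_cast hc
  have hp' : (p : ℚ) ≠ 0 := by exact_mod_cast hp0
  -- the symbol of `γ`
  set s : ℂ := cuspSymbol f γ with hs
  have hsγ : s = modularSymbol f ((a : ℚ) / c) := by rw [hs, cuspSymbol, if_neg hc]
  -- Hecke: `a_p s = ∑ⱼ {∞, (a/c + j)/p} + {∞, p·a/c}`
  have hH := modularSymbol_heckeT_eq_sum p f hp ((a : ℚ) / c)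
  rw [hT, modularSymbol_const_smul, if_neg hpN] at hH
  -- the diagonal term: `δ_D = mkOfCol (pa, c)`, `d ≡ p⁻¹ d`
  have hpa_c : IsCoprime ((p : ℤ) * a) c := (hpP.coprime_iff_not_dvd.mpr hpc).mul_left hac
  set δD : Gamma0 N := Gamma0.mkOfCol ((p : ℤ) * a) c hpa_c hNc with hδD
  have hδD00 : ((δD : SL(2, ℤ)) 0 0 : ℤ) = p * a := Gamma0.mkOfCol_apply_zero_zero _ _ _ _
  have hδD10 : ((δD : SL(2, ℤ)) 1 0 : ℤ) = c := Gamma0.mkOfCol_apply_one_zero _ _ _ _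
  have hsD : cuspSymbol f δD = modularSymbol f (p * ((a : ℚ) / c)) := by
    rw [cuspSymbol, if_neg (by rw [hδD10]; exact hc), hδD00, hδD10]
    congr 1; push_cast; ring
  have hDmod : (p : ZMod N) * ((a : ℤ) : ZMod N) * (((δD : SL(2, ℤ)) 1 1 : ℤ) : ZMod N) = 1 := by
    have h := cast_apply_zero_zero_mul_apply_one_one δD
    rw [hδD00] at h; push_cast at h; exact h
  -- the special index `j₀`: `p ∣ a + j₀ c`
  have hcp : ((c : ℤ) : ZMod p) ≠ 0 := fun h0 ↦ hpc ((ZMod.intCast_zmod_eq_zero_iff_dvd c p).mp h0)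
  set x : ZMod p := -((a : ℤ) : ZMod p) * ((c : ℤ) : ZMod p)⁻¹ with hx
  set j₀ : Fin p := ⟨x.val, x.val_lt⟩ with hj₀
  have hj₀x : ((j₀ : ℕ) : ZMod p) = x := ZMod.natCast_zmod_val x
  have hdiv₀ : (p : ℤ) ∣ a + ((j₀ : ℕ) : ℤ) * c := by
    refine (ZMod.intCast_zmod_eq_zero_iff_dvd _ p).mp ?_
    push_cast; rw [hj₀x, hx]
    field_simp
    ring
  obtain ⟨a₀, ha₀⟩ := hdiv₀
  have hndiv : ∀ j : Fin p, j ≠ j₀ → ¬ (p : ℤ) ∣ a + ((j : ℕ) : ℤ) * c := by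
    intro j hj hdiv
    apply hj
    have hsub : (p : ℤ) ∣ (((j : ℕ) : ℤ) - ((j₀ : ℕ) : ℤ)) * c := by
      have e : (((j : ℕ) : ℤ) - ((j₀ : ℕ) : ℤ)) * c = (a + ((j : ℕ) : ℤ) * c) - (a + ((j₀ : ℕ) : ℤ) * c) := by ring
      rw [e]; exact dvd_sub hdiv ⟨a₀, ha₀⟩
    have hjj : (p : ℤ) ∣ ((j : ℕ) : ℤ) - ((j₀ : ℕ) : ℤ) := (hpP.dvd_or_dvd hsub).resolve_right hpc
    have hjj' : (((j : ℕ) : ℤ) : ZMod p) = (((j₀ : ℕ) : ℤ) : ZMod p) :=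
      (ZMod.intCast_eq_intCast_iff_dvd_sub _ _ p).mpr (dvd_sub_comm.mp hjj)
    have hv : (j : ℕ) = (j₀ : ℕ) := by
      have h1 : ((j : ℕ) : ZMod p) = ((j₀ : ℕ) : ZMod p) := by exact_mod_cast hjj'
      have := (ZMod.natCast_eq_natCast_iff' _ _ _).mp h1
      rwa [Nat.mod_eq_of_lt j.isLt, Nat.mod_eq_of_lt j₀.isLt] at this
    exact Fin.ext hv
  -- the `j₀` term: `δ₀ = mkOfCol (a₀, c)`, `d ≡ p d`
  have ha₀c : IsCoprime a₀ c := by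
    have h : IsCoprime (a + ((j₀ : ℕ) : ℤ) * c) c := by simpa [mul_comm] using hac.add_mul_right_left ((j₀ : ℕ) : ℤ)
    rw [ha₀, mul_comm] at h
    exact h.of_mul_left_left
  set δ₀ : Gamma0 N := Gamma0.mkOfCol a₀ c ha₀c hNc with hδ₀
  have hδ₀00 : ((δ₀ : SL(2, ℤ)) 0 0 : ℤ) = a₀ := Gamma0.mkOfCol_apply_zero_zero _ _ _ _
  have hδ₀10 : ((δ₀ : SL(2, ℤ)) 1 0 : ℤ) = c := Gamma0.mkOfCol_apply_one_zero _ _ _ _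
  have hs₀ : cuspSymbol f δ₀ = modularSymbol f (((a : ℚ) / c + (((j₀ : ℕ) : ℤ) : ℚ)) / p) := by
    rw [cuspSymbol, if_neg (by rw [hδ₀10]; exact hc), hδ₀00, hδ₀10]
    congr 1
    have h : (a : ℚ) + ((j₀ : ℕ) : ℤ) * c = p * a₀ := by exact_mod_cast ha₀
    field_simp
    linear_combination -h
  have h0mod : ((a₀ : ℤ) : ZMod N) * (((δ₀ : SL(2, ℤ)) 1 1 : ℤ) : ZMod N) = 1 := by
    have h := cast_apply_zero_zero_mul_apply_one_one δ₀
    rwa [hδ₀00] at h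
  have hpa₀ : (p : ZMod N) * ((a₀ : ℤ) : ZMod N) = ((a : ℤ) : ZMod N) := by
    have h := congrArg (fun z : ℤ ↦ (z : ZMod N)) ha₀
    simp only [Int.cast_add, Int.cast_mul, Int.cast_natCast, hcN, mul_zero, add_zero] at h
    exact h.symm
  -- the generic terms: `δ_j = mkOfCol (a + jc, pc)`, `d ≡ d`
  have hgen : ∀ j : Fin p, j ≠ j₀ →
      modularSymbol f (((a : ℚ) / c + (((j : ℕ) : ℤ) : ℚ)) / p) - s ∈ periodLatticeGamma1 f := by
    intro j hj
    have hajc : IsCoprime (a + ((j : ℕ) : ℤ) * c) c := by simpa [mul_comm] using hac.add_mul_right_left ((j : ℕ) : ℤ)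
    have hcop : IsCoprime (a + ((j : ℕ) : ℤ) * c) ((p : ℤ) * c) :=
      ((hpP.coprime_iff_not_dvd.mpr (hndiv j hj)).symm).mul_right hajc
    set δ : Gamma0 N := Gamma0.mkOfCol (a + ((j : ℕ) : ℤ) * c) ((p : ℤ) * c) hcop (hNc.mul_left _) with hδ
    have hδ00 : ((δ : SL(2, ℤ)) 0 0 : ℤ) = a + ((j : ℕ) : ℤ) * c := Gamma0.mkOfCol_apply_zero_zero _ _ _ _
    have hδ10 : ((δ : SL(2, ℤ)) 1 0 : ℤ) = p * c := Gamma0.mkOfCol_apply_one_zero _ _ _ _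
    have hpc0 : (p : ℤ) * c ≠ 0 := mul_ne_zero (by exact_mod_cast hp0) hc
    have hsj : cuspSymbol f δ = modularSymbol f (((a : ℚ) / c + (((j : ℕ) : ℤ) : ℚ)) / p) := by
      rw [cuspSymbol, if_neg (by rw [hδ10]; exact hpc0), hδ00, hδ10]
      congr 1; push_cast; field_simp
    have hmod : ((((γ : SL(2, ℤ)) 1 1 : ℤ)) : ZMod N) = (((δ : SL(2, ℤ)) 1 1 : ℤ) : ZMod N) := by
      have h := cast_apply_zero_zero_mul_apply_one_one δ
      rw [hδ00] at h
      push_cast at h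
      rw [hcN, mul_zero, add_zero] at h
      -- `a·d_δ = 1 = a·d` ⟹ `d_δ = d`
      rw [← hdd]
      linear_combination (((δ : SL(2, ℤ)) 1 1 : ℤ) : ZMod N) * had - ((d : ℤ) : ZMod N) * h
    rw [← hsj]
    exact cuspSymbol_sub_mem_periodLatticeGamma1_of_apply_eq f γ δ hmod
  -- the two odd terms together: `d_{δ_D} d_{δ₀} ≡ d²`
  have hpair : cuspSymbol f δD + cuspSymbol f δ₀ - 2 * s ∈ periodLatticeGamma1 f := by
    have hmul1 : cuspSymbol f (δD * δ₀) = cuspSymbol f δD + cuspSymbol f δ₀ := cuspSymbol_mul_holds f δD δ₀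
    have hmul2 : cuspSymbol f (γ * γ) = 2 * s := by rw [cuspSymbol_mul_holds f γ γ, hs]; ring
    have hmod : ((((γ * γ : Gamma0 N) : SL(2, ℤ)) 1 1 : ℤ) : ZMod N) = ((((δD * δ₀ : Gamma0 N) : SL(2, ℤ)) 1 1 : ℤ) : ZMod N) := by
      rw [cast_apply_one_one_mul, cast_apply_one_one_mul, ← hdd]
      set dD := (((δD : SL(2, ℤ)) 1 1 : ℤ) : ZMod N)
      set d0 := (((δ₀ : SL(2, ℤ)) 1 1 : ℤ) : ZMod N)
      linear_combination (dD * d0 * (1 + ((a : ℤ) : ZMod N) * ((d : ℤ) : ZMod N))) * had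
        - (((d : ℤ) : ZMod N) ^ 2 * (((a₀ : ℤ) : ZMod N) * d0)) * hDmod - ((d : ℤ) : ZMod N) ^ 2 * h0mod
        + (((d : ℤ) : ZMod N) ^ 2 * dD * d0 * ((a : ℤ) : ZMod N)) * hpa₀
    have h := cuspSymbol_sub_mem_periodLatticeGamma1_of_apply_eq f (γ * γ) (δD * δ₀) hmod
    rwa [hmul1, hmul2] at h
  -- the sum over `j`: split off `j₀`
  set m : Fin p → ℂ := fun j ↦ modularSymbol f (((a : ℚ) / c + (((j : ℕ) : ℤ) : ℚ)) / p) with hm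
  have hsum : ∑ j : Fin p, m j = m j₀ + ∑ j ∈ Finset.univ.erase j₀, m j :=
    (Finset.add_sum_erase Finset.univ m (Finset.mem_univ j₀)).symm
  have hcard : (Finset.univ.erase j₀).card = p - 1 := by
    rw [Finset.card_erase_of_mem (Finset.mem_univ j₀), Finset.card_univ, Fintype.card_fin]
  have hrest : ∑ j ∈ Finset.univ.erase j₀, m j - ((p : ℂ) - 1) * s ∈ periodLatticeGamma1 f := by
    have e : ∑ j ∈ Finset.univ.erase j₀, m j - ((p : ℂ) - 1) * s = ∑ j ∈ Finset.univ.erase j₀, (m j - s) := by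
      rw [Finset.sum_sub_distrib, Finset.sum_const, hcard, nsmul_eq_mul]
      have hp1 : 1 ≤ p := hp.one_lt.le
      push_cast [Nat.cast_sub hp1]
      ring
    rw [e]
    exact sum_mem fun j hj ↦ hgen j (Finset.ne_of_mem_erase hj)
  -- assemble: `a_p s = m j₀ + Σ' + s_D`, `m j₀ = s₀`
  have hm₀ : m j₀ = cuspSymbol f δ₀ := by rw [hm]; exact hs₀.symm
  have key : ((ap : ℂ) - p - 1) * s =
      (cuspSymbol f δD + cuspSymbol f δ₀ - 2 * s) + (∑ j ∈ Finset.univ.erase j₀, m j - ((p : ℂ) - 1) * s) := by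
    have hH' : (ap : ℂ) * s = ∑ j : Fin p, m j + cuspSymbol f δD := by rw [hsγ, hH, hsD]
    rw [hsum, hm₀] at hH'
    linear_combination hH'
  rw [key]
  exact add_mem hpair hrest

/-- **THE EISENSTEIN CONGRUENCE, every `γ` (UNCONDITIONAL): `(a_p − p − 1)·Λ₀(f) ⊆ Λ₁(f)`** for `T_p f = a_p f`, `a_p ∈ ℤ`, `p ∤ N` prime.  (Reduce to the
representative `γ' = mkOfCol (a_γ, N)` of the same class `d mod N`, which has `c = N`, `p ∤ N`.) [cite: CremonaAlgorithms1997, §2.4 (2.4.1)] [cite: LingOesterle1991, Thm. 1 (shape)] -/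
theorem sub_mul_mem_periodLatticeGamma1_of_heckeT {p : ℕ} [Fact p.Prime] (hpN : ¬ p ∣ N) {ap : ℤ}
    (hT : heckeT (Gamma0 N) 2 p f = (ap : ℂ) • f) {z : ℂ} (hz : z ∈ periodLattice f) :
    ((ap : ℂ) - p - 1) * z ∈ periodLatticeGamma1 f := by
  have hz' : z ∈ (periodLattice f : Set ℂ) := hz
  rw [coe_periodLattice_eq_range] at hz'
  obtain ⟨γ, rfl⟩ := hz'
  -- representative with `c = N`
  have hdet := Matrix.det_fin_two (γ : SL(2, ℤ)).1
  rw [Matrix.SpecialLinearGroup.det_coe] at hdet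
  obtain ⟨c₁, hc₁⟩ : (N : ℤ) ∣ ((γ : SL(2, ℤ)) 1 0 : ℤ) := dvd_entry_of_mem_Gamma0 N γ.2
  have haN : IsCoprime ((γ : SL(2, ℤ)) 0 0 : ℤ) (N : ℤ) :=
    ⟨((γ : SL(2, ℤ)) 1 1 : ℤ), -(((γ : SL(2, ℤ)) 0 1 : ℤ) * c₁), by rw [hc₁] at hdet; linear_combination -hdet⟩
  set γ' : Gamma0 N := Gamma0.mkOfCol ((γ : SL(2, ℤ)) 0 0 : ℤ) (N : ℤ) haN dvd_rfl with hγ'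
  have hγ'00 : ((γ' : SL(2, ℤ)) 0 0 : ℤ) = ((γ : SL(2, ℤ)) 0 0 : ℤ) := Gamma0.mkOfCol_apply_zero_zero _ _ _ _
  have hγ'10 : ((γ' : SL(2, ℤ)) 1 0 : ℤ) = N := Gamma0.mkOfCol_apply_one_zero _ _ _ _
  have hN0 : (N : ℤ) ≠ 0 := by exact_mod_cast NeZero.ne N
  have hcore := sub_mul_cuspSymbol_mem_periodLatticeGamma1_of_heckeT f hpN hT γ' (by rw [hγ'10]; exact hN0)
    (by rw [hγ'10]; exact_mod_cast hpN)
  -- same class: `d_{γ'} ≡ d_γ`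
  have hmod : ((((γ : SL(2, ℤ)) 1 1 : ℤ)) : ZMod N) = (((γ' : SL(2, ℤ)) 1 1 : ℤ) : ZMod N) := by
    have h1 := cast_apply_zero_zero_mul_apply_one_one γ
    have h2 := cast_apply_zero_zero_mul_apply_one_one γ'
    rw [hγ'00] at h2
    linear_combination (((γ' : SL(2, ℤ)) 1 1 : ℤ) : ZMod N) * h1 - ((((γ : SL(2, ℤ)) 1 1 : ℤ)) : ZMod N) * h2
  have hdiff := cuspSymbol_sub_mem_periodLatticeGamma1_of_apply_eq f γ γ' hmod
  have hz : ((ap - p - 1 : ℤ) : ℂ) * (cuspSymbol f γ' - cuspSymbol f γ) ∈ periodLatticeGamma1 f := by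
    have h := (periodLatticeGamma1 f).zsmul_mem hdiff (ap - p - 1)
    rwa [zsmul_eq_mul] at h
  have e : ((ap : ℂ) - p - 1) * cuspSymbol f γ = ((ap : ℂ) - p - 1) * cuspSymbol f γ' - ((ap - p - 1 : ℤ) : ℂ) * (cuspSymbol f γ' - cuspSymbol f γ) := by
    push_cast; ring
  rw [e]
  exact sub_mem hcore hz

end Hecke

/-! ## §2 At `9 ∣ N`: a Shimura third-period forces `a_p(W) ≡ p + 1 (mod 3)` for every prime `p ∤ N` -/

section Nine

variable {W : WeierstrassCurve ℚ} {N : ℕ} [NeZero N]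

/-- `T_p f = a_p(W) f` for the newform of an `X₀(N)`-datum (`IsNewform0.heckeT_eq_coeff_smul`, `IsNewformOf`). [cite: DiamondShurman2005, Prop. 5.8.5] -/
theorem heckeT_eq_lFunction_smul (D : ModularParametrizationData W N) {p : ℕ} [Fact p.Prime] :
    heckeT (Gamma0 N) 2 p D.f = ((W.LFunction p : ℤ) : ℂ) • D.f := by
  haveI : NeZero p := ⟨(Fact.out : p.Prime).ne_zero⟩
  have h := D.isNewformOf.1.heckeT_eq_coeff_smul (Fact.out : p.Prime)
  have hc : cuspCoeff D.f p = ((W.LFunction p : ℤ) : ℂ) := D.isNewformOf.2 p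
  rw [show (UpperHalfPlane.qExpansion 1 ⇑D.f).coeff p = cuspCoeff D.f p from rfl, hc] at h
  exact h

/-- **A Shimura third-period makes the curve Eisenstein mod 3 (UNCONDITIONAL): `KummerShimura D u`, `9 ∣ N`, lattice-optimal ⟹ `3 ∣ a_p(W) − p − 1` for every
prime `p ∤ N`.**  (`Λ₁ = ℤ(3u/c) + 3Λ₀` has index 3; `(a_p − p − 1)Λ₀ ⊆ Λ₁` and `3Λ₀ ⊆ Λ₁`; if `3 ∤ a_p − p − 1`, Bézout would give `Λ₁ = Λ₀`.)
[cite: CremonaAlgorithms1997, §2.4] [cite: LingOesterle1991, Thm. 1 (shape)] -/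
theorem three_dvd_lFunction_sub_of_kummerShimura (D : ModularParametrizationData W N)
    (hopt : ∀ z ∈ D.L.lattice, ∃ w ∈ periodLattice D.f, z = D.c * w) (h9 : 3 ^ 2 ∣ N)
    {u : ℂ} (hu₂ : 3 * u ∈ D.L.lattice) (hS : KummerShimura D u)
    {p : ℕ} [Fact p.Prime] (hpN : ¬ p ∣ N) : (3 : ℤ) ∣ W.LFunction p - p - 1 := by
  by_contra h3
  apply not_kummerShimura_of_periodLatticeGamma1_eq D hopt _ hu₂ hS
  -- Bezout: `z = α·3z + β·(a_p − p − 1)z`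
  have hcop : IsCoprime (3 : ℤ) (W.LFunction p - p - 1) :=
    (Int.isCoprime_iff_gcd_eq_one.mpr (by
      have := Int.gcd_dvd_left 3 (W.LFunction p - p - 1)
      have h2 := Int.gcd_dvd_right 3 (W.LFunction p - p - 1)
      have hprime : Nat.Prime 3 := Nat.prime_three
      rcases (Nat.dvd_prime hprime).mp (by exact_mod_cast this) with h | h
      · exact h
      · exfalso; apply h3; rw [h] at h2; exact_mod_cast h2))
  obtain ⟨α, β, hαβ⟩ := hcop
  refine le_antisymm (periodLatticeGamma1_le_periodLattice D.f) fun z hz ↦ ?_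
  have hA := three_mul_mem_periodLatticeGamma1_of_nine_dvd D h9 hz
  have hB := sub_mul_mem_periodLatticeGamma1_of_heckeT D.f hpN (heckeT_eq_lFunction_smul D) hz
  have h1 : ((α * 3 + β * (W.LFunction p - p - 1) : ℤ) : ℂ) = 1 := by rw [hαβ]; simp
  push_cast at h1
  have key : z = (α : ℂ) * (3 * z) + (β : ℂ) * ((((W.LFunction p : ℤ) : ℂ) - p - 1) * z) := by
    linear_combination -z * h1
  rw [key]
  have ha := (periodLatticeGamma1 D.f).zsmul_mem hA α
  have hb := (periodLatticeGamma1 D.f).zsmul_mem hB β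
  rw [zsmul_eq_mul] at ha hb
  exact add_mem ha hb

/-- **E-an-221 HOLDS OUTRIGHT off the Eisenstein locus**: if some prime `p ∤ N` has `3 ∤ a_p(W) − p − 1`, E-an-221's hypothesis is contradictory (vacuous truth).
[cite: LingOesterle1991, Thm. 1 (shape)] -/
theorem shimuraThreeKernelForcesRationalThreeTorsionAtNine_of_not_eisenstein
    (W : WeierstrassCurve ℚ) [W.IsElliptic] [W.IsGloballyMinimal] {N : ℕ} [NeZero N]
    (D : ModularParametrizationData W N)
    (hopt : ∀ z ∈ D.L.lattice, ∃ w ∈ periodLattice D.f, z = D.c * w) (h9 : 3 ^ 2 ∣ N)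
    {p : ℕ} [Fact p.Prime] (hpN : ¬ p ∣ N) (h3 : ¬ (3 : ℤ) ∣ W.LFunction p - p - 1)
    (u : ℂ) (hu₂ : 3 * u ∈ D.L.lattice) (hS : KummerShimura D u) : ∃ X Y : ℚ, IsShortThreeTorsion W D.c X Y :=
  absurd (three_dvd_lFunction_sub_of_kummerShimura D hopt h9 hu₂ hS hpN) h3

end Nine

end Summit.BirchSwinnertonDyer.BirchSwinnertonDyer.Theorems.ManinLocalTwoThree.SigmaHabitat

end
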